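import Mathlib
import Literature.Analysis.FluidPDE.TypeIAncientMild
import Literature.Analysis.FluidPDE.SpaceTimeCalculus
import HarnessLib

/-!
# Route SymmetryModuliCount — the vertex lemma (interior-vertex vanishing)

Theorems file serving the crux item stmt-NavierStokesRegularity-4052
(`Summit.NavierStokesRegularity.NavierStokesRegularity.Theses.SymmetryModuliCount.ForcedSymmetry`),
line `time-anchor-bootstrap`, registered stub 3 `stub_interiorVertexVanishing` (the VERTEX LEMMA):

* if a Type-I KNSS-mild ancient field `u ∈ A_C` (`IsTypeIAncientMild C u`) is annihilated on a
  backward end `t < T` (`T ≤ 0`) by a (rotated) scaling generator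
  `∇u·(a + σx + Ax) + σu + 2σ(t − θ)∂ₜu − Au = 0` (`σ ≠ 0`, `A` skew, `⟪Ax, x⟫ = 0`) whose time
  vertex `θ` lies in the OPEN slab, `θ < 0`, and in the closed end, `θ ≤ T`, then `u ≡ 0` on
  `t < T`.

## Proof (characteristics; uses only joint differentiability of `u` on the open slab)

1. *Centre.* `σ + A` is injective (`⟪(σ + A)x, x⟫ = σ‖x‖²`), hence bijective (finite dimension),
   so there is `x_c` with `σx_c + Ax_c = −a`, i.e. `a + σx + Ax = (σ + A)(x − x_c)`
   (`vertex_exists_center`).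
2. *Characteristic.* Fix `t₀ < T`, `x₀`. With `B = σ⁻¹A` (skew) put
   `t(r) = θ + e^{2r}(t₀ − θ)`, `x(r) = x_c + eʳ e^{rB}(x₀ − x_c)` (`NormedSpace.exp` in the Banach
   algebra `E →L[ℝ] E`); then `t' = 2(t − θ)`, `x' = (x − x_c) + B(x − x_c) = σ⁻¹(a + σx + Ax)`
   (`vertex_hasDerivAt_char`), `t(r) < T` for `r ≤ 0`, `t(0) = t₀`, `x(0) = x₀`.
3. *Restriction.* `v(r) = u(t(r), x(r))`; by the chain rule through `uncurry u`
   (`vertex_hasDerivAt_along`, with the tree's `hasDerivAt_timeLine` / `hasFDerivAt_slice`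
   identifying the partials with `timeDeriv` and the slice `fderiv`) and the generator identity at
   `t = t(r) < T`, `v' = σ⁻¹Av − v`.
4. *Energy.* `d/dr (e^{2r}‖v‖²) = 0` since `⟪Av, v⟫ = 0` (`vertex_hasDerivAt_exp_mul_norm_sq`), so
   `e^{2r}‖v(r)‖² = ‖u(t₀, x₀)‖²` for `r ≤ 0` (mean value inequality on the convex set `(-∞, 0]`).
5. *Limit `r → −∞`.* `‖e^{rB}y‖ = ‖y‖` (`vertex_norm_exp_smul_apply`, same energy argument), so
   `(t(r), x(r)) → (θ, x_c)`, an interior point of the slab where `u` is continuous: `‖v(r)‖²`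
   converges, while `‖v(r)‖² = e^{−2r}‖u(t₀,x₀)‖² → +∞` unless `u(t₀, x₀) = 0`.

Only joint differentiability of `uncurry u` on `(-∞,0) × E` is used (projection
`IsTypeIAncientMild.contDiffOn`); the Oseen identity, incompressibility and the Type-I bound are
not. The analytic core is stated for any finite-dimensional real inner product space `E`
(`vertex_vanishing_of_differentiableOn`) and then specialised to `ℝ³` verbatim in the registered
signature.

## References

Elementary (method of characteristics for a first-order linear transport identity); no published
source is followed. Skeleton: `Cruxes/ForcedSymmetry/Lines/time-anchor-bootstrap.lean`, stub 3.
-/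

noncomputable section

-- the summit and its single sub-problem share the name (CONVENTIONS §1), as in every Theorems file
set_option linter.dupNamespace false

open Set Filter Topology Function
open Literature.Analysis.FluidPDE
open scoped RealInnerProductSpace

namespace Summit.NavierStokesRegularity.NavierStokesRegularity.Theorems

variable {E : Type*} [NormedAddCommGroup E] [InnerProductSpace ℝ E]

/-- **Centre of a rotated scaling generator.** If `σ ≠ 0` and `A` is skew (`⟪Ax, x⟫ = 0`), then
`σ + A` is injective (`⟪(σ + A)x, x⟫ = σ‖x‖²`), hence surjective in finite dimension: every `a`
is `−(σx_c + Ax_c)` for some centre `x_c`. [folklore] -/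
theorem vertex_exists_center [FiniteDimensional ℝ E] {σ : ℝ} (hσ : σ ≠ 0) {A : E →L[ℝ] E}
    (hA : ∀ x, ⟪A x, x⟫ = 0) (a : E) : ∃ xc : E, σ • xc + A xc = -a := by
  set M : E →ₗ[ℝ] E := σ • LinearMap.id + (A : E →ₗ[ℝ] E) with hM
  have hinj : Function.Injective M := by
    refine (injective_iff_map_eq_zero M).2 fun x hx => ?_
    have h1 : ⟪M x, x⟫ = σ * ‖x‖ ^ 2 := by
      simp only [hM, LinearMap.add_apply, LinearMap.smul_apply, LinearMap.id_apply,
        ContinuousLinearMap.coe_coe, inner_add_left, real_inner_smul_left, hA x, add_zero,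
        real_inner_self_eq_norm_sq]
    rw [hx, inner_zero_left] at h1
    have h2 : ‖x‖ ^ 2 = 0 := by
      rcases mul_eq_zero.1 h1.symm with h | h
      · exact absurd h hσ
      · exact h
    exact norm_eq_zero.1 ((pow_eq_zero_iff two_ne_zero).1 h2)
  obtain ⟨xc, hxc⟩ := (LinearMap.injective_iff_surjective.1 hinj) (-a)
  refine ⟨xc, ?_⟩
  simpa [hM] using hxc

/-- **The one-parameter group of a skew generator is isometric**: if `⟪Bx, x⟫ = 0` for all `x`
then `‖e^{cB} y‖ = ‖y‖` (`d/dc ‖e^{cB}y‖² = 2⟪e^{cB}y, B e^{cB}y⟫ = 0`). [folklore] -/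
theorem vertex_norm_exp_smul_apply [CompleteSpace E] {B : E →L[ℝ] E} (hB : ∀ x, ⟪B x, x⟫ = 0)
    (y : E) (c : ℝ) : ‖NormedSpace.exp (c • B) y‖ = ‖y‖ := by
  have hd : ∀ s : ℝ, HasDerivAt (fun s : ℝ => NormedSpace.exp (s • B) y)
      (B (NormedSpace.exp (s • B) y)) s := by
    intro s
    have h := (hasDerivAt_exp_smul_const' (𝕂 := ℝ) B s).clm_apply (hasDerivAt_const s y)
    simpa using h
  have hd2 : ∀ s : ℝ, HasDerivAt (fun s : ℝ => ‖NormedSpace.exp (s • B) y‖ ^ 2) 0 s := by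
    intro s
    have h := (hd s).norm_sq
    rw [real_inner_comm, hB, mul_zero] at h
    exact h
  have hconst := is_const_of_deriv_eq_zero (fun s => (hd2 s).differentiableAt)
    (fun s => (hd2 s).deriv) c 0
  simp only [zero_smul, NormedSpace.exp_zero, one_apply_eq_self] at hconst
  exact (sq_eq_sq₀ (norm_nonneg _) (norm_nonneg _)).1 hconst

/-- **The spatial characteristic** `r ↦ x_c + eʳ e^{rB} y` has derivative `z + Bz` at `r`, where
`z = eʳ e^{rB} y` is its displacement from the centre (`d/dr e^{rB} = B e^{rB}`, Mathlib
`hasDerivAt_exp_smul_const'`). [folklore] -/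
theorem vertex_hasDerivAt_char [CompleteSpace E] (B : E →L[ℝ] E) (xc₀ y : E) (r : ℝ) :
    HasDerivAt (fun s : ℝ => xc₀ + Real.exp s • NormedSpace.exp (s • B) y)
      (Real.exp r • NormedSpace.exp (r • B) y + B (Real.exp r • NormedSpace.exp (r • B) y)) r := by
  have h1 : HasDerivAt (fun s : ℝ => NormedSpace.exp (s • B) y)
      (B (NormedSpace.exp (r • B) y)) r := by
    have h := (hasDerivAt_exp_smul_const' (𝕂 := ℝ) B r).clm_apply (hasDerivAt_const r y)
    simpa using h
  have h3 := ((Real.hasDerivAt_exp r).fun_smul h1).const_add xc₀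
  convert h3 using 1
  rw [map_smul, add_comm]

/-- **Chain rule along a space–time curve.** If `uncurry u` has Fréchet derivative `L` at
`(t(r), x(r))` and `t`, `x` have derivatives `t'`, `x'` at `r`, then `s ↦ u (t s) (x s)` has
derivative `t' • ∂ₜu(t(r), x(r)) + D(u (t r))(x(r)) x'` at `r` (the partials of the joint derivative
are the tree's `timeDeriv` and slice `fderiv`: `hasDerivAt_timeLine`, `hasFDerivAt_slice`). [folklore] -/
theorem vertex_hasDerivAt_along {F : Type*} [NormedAddCommGroup F] [NormedSpace ℝ F]
    {u : ℝ → E → F} {tc : ℝ → ℝ} {xc : ℝ → E} {tc' : ℝ} {xc' : E} {r : ℝ}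
    {L : ℝ × E →L[ℝ] F} (hL : HasFDerivAt (uncurry u) L (tc r, xc r))
    (htc : HasDerivAt tc tc' r) (hxc : HasDerivAt xc xc' r) :
    HasDerivAt (fun s => u (tc s) (xc s))
      (tc' • timeDeriv u (tc r) (xc r) + fderiv ℝ (u (tc r)) (xc r) xc') r := by
  have h := hL.comp_hasDerivAt r (htc.prodMk hxc)
  have e1 : timeDeriv u (tc r) (xc r) = L (1, 0) := (hasDerivAt_timeLine hL).deriv
  have e2 : fderiv ℝ (u (tc r)) (xc r) xc' = L (0, xc') := by
    rw [(hasFDerivAt_slice hL).fderiv]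
    rfl
  have e3 : L (tc', xc') = tc' • L (1, 0) + L (0, xc') := by
    rw [← map_smul, ← map_add]
    congr 1
    simp
  rw [e1, e2, ← e3]
  exact h

/-- **Energy identity.** If `v' = σ⁻¹Av − v` at `r` with `A` skew, then
`d/dr (e^{2r}‖v‖²) = 2e^{2r}‖v‖² + e^{2r}·2⟪v, σ⁻¹Av − v⟫ = 0` at `r`. [folklore] -/
theorem vertex_hasDerivAt_exp_mul_norm_sq {v : ℝ → E} {r σ : ℝ} {A : E →L[ℝ] E}
    (hA : ∀ x, ⟪A x, x⟫ = 0) (hv : HasDerivAt v (σ⁻¹ • A (v r) - v r) r) :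
    HasDerivAt (fun s => Real.exp (2 * s) * ‖v s‖ ^ 2) 0 r := by
  have h1 : HasDerivAt (fun s => Real.exp (2 * s)) (Real.exp (2 * r) * 2) r := by
    convert ((hasDerivAt_id' r).const_mul (2 : ℝ)).exp using 1
    ring
  refine (h1.fun_mul hv.norm_sq).congr_deriv ?_
  rw [inner_sub_right, real_inner_smul_right, real_inner_comm (A (v r)) (v r), hA, mul_zero,
    zero_sub, real_inner_self_eq_norm_sq]
  ring

/-- **The vertex lemma, analytic core** (any finite-dimensional real inner product space). Let
`uncurry u` be differentiable on the open slab `(-∞, 0) × E`, and suppose the rotated scaling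
generator with `σ ≠ 0`, `A` skew and time vertex `θ < 0`, `θ ≤ T ≤ 0`, annihilates `u` on `t < T`:
`D(u t)(x)(a + σx + Ax) + σ u + 2σ(t − θ) ∂ₜu − A u = 0`. Then `u ≡ 0` on `t < T`. Proof by
characteristics running into the interior vertex `(θ, x_c)` (module docstring, steps 1–5). [folklore] -/
theorem vertex_vanishing_of_differentiableOn [FiniteDimensional ℝ E] [CompleteSpace E]
    {u : ℝ → E → E} (hd : DifferentiableOn ℝ (uncurry u) (Iio 0 ×ˢ univ))
    {a : E} {σ : ℝ} {A : E →L[ℝ] E} {θ T : ℝ}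
    (hA : ∀ x, ⟪A x, x⟫ = 0) (hσ : σ ≠ 0) (hθ : θ < 0) (hθT : θ ≤ T) (hT : T ≤ 0)
    (hgen : ∀ t < T, ∀ x, fderiv ℝ (u t) x (a + σ • x + A x) + σ • u t x +
      (2 * σ * (t - θ)) • timeDeriv u t x - A (u t x) = 0) :
    ∀ t < T, ∀ x, u t x = 0 := by
  intro t₀ ht₀ x₀
  -- Step 1: the centre `x_c` and the skew generator `B = σ⁻¹ A`
  obtain ⟨x_c, hxc⟩ := vertex_exists_center hσ hA a
  obtain ⟨B, hB_def⟩ : ∃ B : E →L[ℝ] E, B = σ⁻¹ • A := ⟨_, rfl⟩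
  have hB : ∀ x, ⟪B x, x⟫ = 0 := fun x => by
    rw [hB_def, smul_apply, real_inner_smul_left, hA x, mul_zero]
  -- Step 2: the characteristic through `(t₀, x₀)`
  obtain ⟨tc, htc_def⟩ : ∃ tc : ℝ → ℝ, tc = fun r => θ + Real.exp (2 * r) * (t₀ - θ) := ⟨_, rfl⟩
  obtain ⟨xc, hxc_def⟩ :
      ∃ xc : ℝ → E, xc = fun r => x_c + Real.exp r • NormedSpace.exp (r • B) (x₀ - x_c) :=
    ⟨_, rfl⟩
  have htc0 : tc 0 = t₀ := by simp [htc_def]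
  have hxc0 : xc 0 = x₀ := by simp [hxc_def]
  have htcT : ∀ r ≤ (0 : ℝ), tc r < T := by
    intro r hr
    have he1 : Real.exp (2 * r) ≤ 1 := Real.exp_le_one_iff.2 (by linarith)
    have he0 : 0 < Real.exp (2 * r) := Real.exp_pos _
    rw [htc_def]
    rcases le_or_gt θ t₀ with h | h
    · have := mul_le_of_le_one_left (sub_nonneg.2 h) he1
      show θ + Real.exp (2 * r) * (t₀ - θ) < T
      linarith
    · have := mul_neg_of_pos_of_neg he0 (sub_neg.2 h)
      show θ + Real.exp (2 * r) * (t₀ - θ) < T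
      linarith
  have htc' : ∀ r, HasDerivAt tc (2 * (tc r - θ)) r := by
    intro r
    have e : 2 * (tc r - θ) = Real.exp (2 * r) * (2 * 1) * (t₀ - θ) := by
      simp only [htc_def]
      ring
    rw [e, htc_def]
    exact (((hasDerivAt_id' r).const_mul (2 : ℝ)).exp.mul_const (t₀ - θ)).const_add θ
  have hxc' : ∀ r, HasDerivAt xc ((xc r - x_c) + B (xc r - x_c)) r := by
    intro r
    have e : xc r - x_c = Real.exp r • NormedSpace.exp (r • B) (x₀ - x_c) := by simp [hxc_def]
    rw [e, hxc_def]
    exact vertex_hasDerivAt_char B x_c (x₀ - x_c) r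
  have hU : IsOpen (Iio (0 : ℝ) ×ˢ (univ : Set E)) := isOpen_Iio.prod isOpen_univ
  -- Steps 3–4: along the characteristic, `v' = σ⁻¹ A v - v`, so `e^{2r} ‖v r‖²` is stationary
  have hφ : ∀ r ≤ (0 : ℝ),
      HasDerivAt (fun s => Real.exp (2 * s) * ‖u (tc s) (xc s)‖ ^ 2) 0 r := by
    intro r hr
    have hmem : (tc r, xc r) ∈ Iio (0 : ℝ) ×ˢ (univ : Set E) :=
      ⟨(htcT r hr).trans_le hT, mem_univ _⟩
    have hL := ((hd _ hmem).differentiableAt (hU.mem_nhds hmem)).hasFDerivAt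
    have hv := vertex_hasDerivAt_along hL (htc' r) (hxc' r)
    have hv2 : HasDerivAt (fun s => u (tc s) (xc s))
        (σ⁻¹ • A (u (tc r) (xc r)) - u (tc r) (xc r)) r := by
      refine hv.congr_deriv ?_
      have key := hgen (tc r) (htcT r hr) (xc r)
      have e1 : a + σ • xc r + A (xc r) = σ • ((xc r - x_c) + B (xc r - x_c)) := by
        rw [neg_eq_iff_eq_neg.1 hxc.symm, hB_def, smul_apply, smul_add,
          smul_smul, mul_inv_cancel₀ hσ, one_smul, smul_sub, map_sub]
        abel
      rw [e1, map_smul] at key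
      apply smul_right_injective E hσ
      show σ • _ = σ • _
      rw [smul_add, smul_sub, smul_smul, smul_smul, mul_inv_cancel₀ hσ, one_smul]
      linear_combination (norm := module) key
    exact vertex_hasDerivAt_exp_mul_norm_sq hA hv2
  -- constancy on `(-∞, 0]`
  have hconst : ∀ r ≤ (0 : ℝ),
      Real.exp (2 * r) * ‖u (tc r) (xc r)‖ ^ 2 = ‖u t₀ x₀‖ ^ 2 := by
    intro r hr
    have h := (convex_Iic (0 : ℝ)).norm_image_sub_le_of_norm_hasDerivWithin_le
      (f := fun s => Real.exp (2 * s) * ‖u (tc s) (xc s)‖ ^ 2) (f' := fun _ => (0 : ℝ)) (C := 0)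
      (fun s hs => (hφ s hs).hasDerivWithinAt) (fun _ _ => by rw [norm_zero]) hr Set.self_mem_Iic
    simp only [zero_mul, norm_le_zero_iff, sub_eq_zero] at h
    rw [← h, htc0, hxc0, mul_zero, Real.exp_zero, one_mul]
  -- Step 5: the limit `r → -∞`
  by_contra hne
  have hc : 0 < ‖u t₀ x₀‖ ^ 2 := pow_pos (norm_pos_iff.2 hne) 2
  have hlim_t : Tendsto tc atBot (𝓝 θ) := by
    have h2 : Tendsto (fun r : ℝ => Real.exp (2 * r)) atBot (𝓝 0) :=
      Real.tendsto_exp_atBot.comp (tendsto_id.const_mul_atBot two_pos)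
    rw [htc_def]
    simpa using (h2.mul_const (t₀ - θ)).const_add θ
  have hlim_x : Tendsto xc atBot (𝓝 x_c) := by
    have h1 : Tendsto (fun r : ℝ => Real.exp r • NormedSpace.exp (r • B) (x₀ - x_c)) atBot (𝓝 0) := by
      refine squeeze_zero_norm (fun r => ?_)
        (by simpa using Real.tendsto_exp_atBot.mul_const ‖x₀ - x_c‖)
      rw [norm_smul, Real.norm_eq_abs, abs_of_pos (Real.exp_pos r), vertex_norm_exp_smul_apply hB]
    rw [hxc_def]
    simpa using tendsto_const_nhds.add h1
  have hmem0 : (θ, x_c) ∈ Iio (0 : ℝ) ×ˢ (univ : Set E) := ⟨hθ, mem_univ _⟩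
  have hcont : ContinuousAt (uncurry u) (θ, x_c) :=
    ((hd _ hmem0).differentiableAt (hU.mem_nhds hmem0)).continuousAt
  have hlim_v : Tendsto (fun r => ‖u (tc r) (xc r)‖ ^ 2) atBot (𝓝 (‖u θ x_c‖ ^ 2)) :=
    ((hcont.tendsto.comp (hlim_t.prodMk_nhds hlim_x)).norm).pow 2
  have hblow : Tendsto (fun r : ℝ => Real.exp (-(2 * r)) * ‖u t₀ x₀‖ ^ 2) atBot atTop := by
    have h3 : Tendsto (fun r : ℝ => -(2 * r)) atBot atTop :=
      tendsto_neg_atBot_atTop.comp (tendsto_id.const_mul_atBot two_pos)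
    exact (Real.tendsto_exp_atTop.comp h3).atTop_mul_const hc
  have heq : (fun r : ℝ => Real.exp (-(2 * r)) * ‖u t₀ x₀‖ ^ 2) =ᶠ[atBot]
      fun r => ‖u (tc r) (xc r)‖ ^ 2 := by
    filter_upwards [eventually_le_atBot (0 : ℝ)] with r hr
    rw [← hconst r hr, ← mul_assoc, ← Real.exp_add, neg_add_cancel, Real.exp_zero, one_mul]
  exact not_tendsto_atTop_of_tendsto_nhds hlim_v (hblow.congr' heq)

/-- **Registered stub 3 of line `time-anchor-bootstrap` (interior-vertex vanishing — the vertex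
lemma).** If `u ∈ A_C` (`IsTypeIAncientMild C u`) is annihilated on a backward end `t < T`
(`T ≤ 0`) by a (rotated) scaling generator (`σ ≠ 0`, `A` skew) whose time vertex `θ` lies in the
open slab, `θ < 0`, and in the closed end, `θ ≤ T`, then `u ≡ 0` on `t < T`. Immediate from the
analytic core `vertex_vanishing_of_differentiableOn` and the joint smoothness of `u` on the open
slab (`IsTypeIAncientMild.contDiffOn`); the Oseen identity, incompressibility and the Type-I bound
are not used. Signature = `Sig.stub_interiorVertexVanishing` of the skeleton, verbatim. [folklore] -/
theorem stub_interiorVertexVanishing :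
    ∀ (C : ℝ) (u : ℝ → EuclideanSpace ℝ (Fin 3) → EuclideanSpace ℝ (Fin 3)),
      Literature.Analysis.FluidPDE.IsTypeIAncientMild C u →
      ∀ (a : EuclideanSpace ℝ (Fin 3)) (σ : ℝ) (A : EuclideanSpace ℝ (Fin 3) →L[ℝ] EuclideanSpace ℝ (Fin 3)) (θ T : ℝ),
        (∀ x, inner ℝ (A x) x = 0) → σ ≠ 0 → θ < 0 → θ ≤ T → T ≤ 0 →
        (∀ t < T, ∀ x, fderiv ℝ (u t) x (a + σ • x + A x) + σ • u t x +
          (2 * σ * (t - θ)) • Literature.Analysis.FluidPDE.timeDeriv u t x - A (u t x) = 0) →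
        ∀ t < T, ∀ x, u t x = 0 := by
  intro C u hu a σ A θ T hA hσ hθ hθT hT hgen
  exact vertex_vanishing_of_differentiableOn (hu.contDiffOn.differentiableOn (by simp))
    hA hσ hθ hθT hT hgen

end Summit.NavierStokesRegularity.NavierStokesRegularity.Theorems

end
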